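import Summits.AtomisticToContinuum.BoseEinsteinCondensation.Theses.BECHusimiAmplitudeGas
import Summits.AtomisticToContinuum.BoseEinsteinCondensation.Theorems.BECHusimiAmplitudeGasPositivityReductionShiftedModulus
import Summits.AtomisticToContinuum.BoseEinsteinCondensation.Theorems.BECHusimiAmplitudeGasPositivityReductionStability
import Literature.Barriers.AtomisticToContinuum.KineticGapLengthScalesThermodynamicWindow
import HarnessLib

/-!
# Route BECHusimiAmplitudeGas — `PositivityReduction` (item stmt-AtomisticToContinuum-11998), part 5:
# the reduction for EVERY pair potential, conditionally on the periodic Ky Fan gap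

`PositivityReduction` (the route decl, by name) is proved here from ONE explicit hypothesis, the
**dilute periodic Ky Fan gap**: for every repulsive finite-range `v` there is `ρ₁ > 0` such that for
`0 < ρ < ρ₁` and all large `N`, `2 · periodicGroundStateEnergy v N L_N < kyFanTwo v N L_N` on the torus
of side `L_N = (N/ρ)^{1/3}` — simplicity of the bosonic ground state of `-∑Δⱼ + ∑ v^per(xᵢ-xⱼ)` in
the tree's variational (Ky Fan) vocabulary (`positivityReduction_of_kyFanGap`). Everything else is
unconditional and holds for all admissible `v`, hard cores included:

* finite box energies at small density, eventually in `N` (tree: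
  `Literature.Barriers.AtomisticToContinuum.BoseGas.exists_eventually_periodicGroundStateEnergy_lt_top`, Ruelle);
* nonnegative `δ`-near-minimisers for every `δ > 0` (part 4, shifted modulus:
  `exists_nonneg_nearMinimiser_of_ne_top`);
* clustering of near-minimisers from the Ky Fan gap by the parallelogram law (tree:
  `exists_phase_integral_norm_sub_sq_le_of_kyFanGap`) and the Lipschitz bound for `n₀`
  (`condensateOccupation_le_of_sub_le`), giving the two-near-minimiser stability
  `condensateOccupation_le_of_nearMinimisers_of_kyFanGap`;
* the transfer `c ↦ c/2`, `δ = min δ₁ δ₂` (`periodicBEC_of_periodicBECNonneg_of_kyFanGap`).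

The hypothesis is DISCHARGED in the tree for bounded `v` (`kyFanGap_eventually_of_bounded`, from
`PeriodicGroundStateNondegenerate_holds`, Reed–Simon IV §XIII.12 via Feynman–Kac), which recovers the
unconditional bounded case of part 3. For hard cores / unbounded `v` it is the one missing input:
nondegeneracy of the periodic hard-core ground state at low density (connectedness of the dilute
hard-sphere configuration space of the torus and Perron–Frobenius for the Dirichlet form on it), not
in the tree and not in print at these densities.
-/

noncomputable section

open MeasureTheory Filter Set Complex
open scoped ENNReal NNReal Topology ComplexConjugate

namespace Summit.AtomisticToContinuum.BoseEinsteinCondensation.Theorems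

open Literature.MathematicalPhysics.QuantumManyBody.BoseGas Literature.Analysis.InnerProduct
  Literature.MathematicalPhysics.QuantumManyBody Literature.Barriers.AtomisticToContinuum.BoseGas

variable {N : ℕ} {L : ℝ}

/-! ### Two near-minimisers have close condensate occupations, from the Ky Fan gap -/

/-- A strict Ky Fan gap `2E₀ < K₂` with `E₀ < ∞` is a gap by a positive real: `2E₀ + γ ≤ K₂`,
`γ > 0` (`γ = 1` if `K₂ = ∞`, else `γ = K₂ - 2E₀`). [folklore] -/
theorem exists_ofReal_gap_of_two_mul_lt {E K : ℝ≥0∞} (hE : E ≠ ⊤) (h : 2 * E < K) :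
    ∃ γ : ℝ, 0 < γ ∧ 2 * E + ENNReal.ofReal γ ≤ K := by
  by_cases hK : K = ⊤
  · exact ⟨1, one_pos, hK ▸ le_top⟩
  have h2E : 2 * E ≠ ⊤ := ENNReal.mul_ne_top ENNReal.ofNat_ne_top hE
  have hsub0 : K - 2 * E ≠ 0 := (tsub_pos_of_lt h).ne'
  have hsubtop : K - 2 * E ≠ ⊤ := ENNReal.sub_ne_top hK
  refine ⟨(K - 2 * E).toReal, ENNReal.toReal_pos hsub0 hsubtop, ?_⟩
  rw [ENNReal.ofReal_toReal hsubtop, add_tsub_cancel_of_le h.le]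

/-- **Stability of the condensate occupation between two near-minimisers, from the Ky Fan gap**
(every measurable pair potential, hard cores included). At fixed `N`, `L > 0` with
`E₀ = periodicGroundStateEnergy v N L < ∞` and `2E₀ < kyFanTwo v N L`, for every `ε > 0` there is
`δ > 0` such that any two `δ`-near-minimisers `Ψ, Φ` satisfy `n₀(Ψ) ≤ n₀(Φ) + εN`: clustering
`∫_cell |Ψ - e^{iθ}Φ|² ≤ η²` (`exists_phase_integral_norm_sub_sq_le_of_kyFanGap`, parallelogram law)
and the Lipschitz bound `n₀(Ψ) ≤ n₀(e^{iθ}Φ) + N(2η + η²)`, `η = min(ε/3, 1)`.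
[cite: ReedSimonIV1978, Thm. XIII.1–2] -/
theorem condensateOccupation_le_of_nearMinimisers_of_kyFanGap {v : ℝ → ℝ≥0∞} (hv : Measurable v)
    (N : ℕ) (hL : 0 < L) (hE : periodicGroundStateEnergy v N L ≠ ⊤)
    (hgap : 2 * periodicGroundStateEnergy v N L < kyFanTwo v N L) {ε : ℝ} (hε : 0 < ε) :
    ∃ δ : ℝ≥0∞, 0 < δ ∧ ∀ Ψ Φ : PeriodicTrialState N L,
      periodicEnergy v Ψ ≤ periodicGroundStateEnergy v N L + δ →
      periodicEnergy v Φ ≤ periodicGroundStateEnergy v N L + δ →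
      condensateOccupation N L Ψ.ψ ≤ condensateOccupation N L Φ.ψ + ENNReal.ofReal (ε * N) := by
  rcases N with _ | n
  · refine ⟨1, one_pos, fun Ψ Φ _ _ => ?_⟩
    simp [condensateOccupation, occupation]
  obtain ⟨γ, hγ, hgap'⟩ := exists_ofReal_gap_of_two_mul_lt hE hgap
  -- the tolerance
  set η : ℝ := min (ε / 3) 1 with hη
  have hη0 : 0 < η := lt_min (by linarith) one_pos
  have hηε : 2 * η + η ^ 2 ≤ ε := by nlinarith [min_le_left (ε / 3) 1, min_le_right (ε / 3) 1]
  obtain ⟨δ, hδ, hclus⟩ := exists_phase_integral_norm_sub_sq_le_of_kyFanGap (N := n + 1) (L := L)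
    hv hγ hE hgap' (η := η ^ 2) (by positivity)
  refine ⟨δ, hδ, fun Ψ Φ hΨ hΦ => ?_⟩
  obtain ⟨θ, hθ⟩ := hclus Ψ Φ hΨ hΦ
  set c : ℂ := Complex.exp (↑θ * Complex.I) with hc
  have hc1 : ‖c‖ = 1 := Complex.norm_exp_ofReal_mul_I θ
  -- `∫⁻_cell |Ψ - cΦ|² ≤ η²`
  have hcontd : Continuous fun X => Ψ.ψ X - c * Φ.ψ X :=
    Ψ.contDiff.continuous.sub (continuous_const.mul Φ.contDiff.continuous)
  have hcell : ∫⁻ X in cellN (n + 1) L, (‖Ψ.ψ X - c * Φ.ψ X‖₊ : ℝ≥0∞) ^ 2 ≤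
      ENNReal.ofReal (η ^ 2) := by
    have hfin : (∫⁻ X in cellN (n + 1) L, (‖Ψ.ψ X - c * Φ.ψ X‖₊ : ℝ≥0∞) ^ 2) ≠ ⊤ :=
      (lintegral_cellN_sq_lt_top L hcontd).ne
    rw [← ENNReal.ofReal_toReal hfin, ← integral_cellN_norm_sq_eq_toReal L hcontd]
    exact ENNReal.ofReal_le_ofReal hθ
  -- the Lipschitz estimate for `n₀`
  have hc'n : ((‖c‖₊ : ℝ≥0) : ℝ≥0∞) = 1 := by
    rw [← ENNReal.coe_one, ENNReal.coe_inj, ← NNReal.coe_inj, coe_nnnorm, hc1, NNReal.coe_one]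
  have hcontg : Continuous fun X => c * Φ.ψ X := continuous_const.mul Φ.contDiff.continuous
  have hg1 : ∫⁻ X in cellN (n + 1) L, (‖c * Φ.ψ X‖₊ : ℝ≥0∞) ^ 2 ≤ 1 := by
    have hX : ∀ X, (‖c * Φ.ψ X‖₊ : ℝ≥0∞) ^ 2 = (‖Φ.ψ X‖₊ : ℝ≥0∞) ^ 2 := fun X => by
      rw [nnnorm_mul, ENNReal.coe_mul, mul_pow, hc'n, one_pow, one_mul]
    simp only [hX]
    rw [Φ.norm_eq]
  have hmain := condensateOccupation_le_of_sub_le hL Ψ.contDiff.continuous hcontg hg1 hη0 hcell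
  rw [condensateOccupation_const_mul hL c Φ.ψ, hc'n, one_pow, one_mul] at hmain
  refine hmain.trans (add_le_add le_rfl (ENNReal.ofReal_le_ofReal ?_))
  rw [mul_comm]
  exact mul_le_mul_of_nonneg_right hηε (Nat.cast_nonneg _)

/-! ### The reduction at one potential, from the Ky Fan gap -/

/-- **Positivity reduction at one potential, from the dilute periodic Ky Fan gap.** Let `v` be a
repulsive finite-range pair potential (hard cores allowed) such that for `0 < ρ < ρ₁` and all large
`N` the periodic ground state on the torus of side `(N/ρ)^{1/3}` is nondegenerate in Ky Fan form,
`2E₀ < kyFanTwo`. If for `0 < ρ < ρ₀` there is `c > 0` such that for all large `N` some `δ > 0` makes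
every NONNEGATIVE periodic `δ`-near-minimiser have `n₀ ≥ cN`, then for
`0 < ρ < min ρ₀ (min ρ₁ ρ₂)` (`ρ₂` the finite-energy threshold) the same holds with `c/2` for ALL
periodic near-minimisers: at fixed large `N`, `δ = min δ₁ δ₂` with `δ₂ = δ₂(c/2)` from
`condensateOccupation_le_of_nearMinimisers_of_kyFanGap`, a nonnegative `δ`-near-minimiser `Φ₊`
(`exists_nonneg_nearMinimiser_of_ne_top`) has `n₀(Φ₊) ≥ cN` and `n₀(Φ₊) ≤ n₀(Ψ) + (c/2)N`.
[folklore] -/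
theorem periodicBEC_of_periodicBECNonneg_of_kyFanGap {v : ℝ → ℝ≥0∞} (hv : IsRepulsiveFiniteRange v)
    {ρ₀ ρ₁ : ℝ} (hρ₀ : 0 < ρ₀) (hρ₁ : 0 < ρ₁)
    (hgap : ∀ ρ : ℝ, 0 < ρ → ρ < ρ₁ → ∀ᶠ N : ℕ in Filter.atTop,
      2 * periodicGroundStateEnergy v N (sideLength ρ N) < kyFanTwo v N (sideLength ρ N))
    (hnn : ∀ ρ : ℝ, 0 < ρ → ρ < ρ₀ → ∃ c : ℝ, 0 < c ∧ ∀ᶠ N : ℕ in Filter.atTop, ∃ δ : ℝ≥0∞, 0 < δ ∧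
      ∀ Ψ : PeriodicTrialState N (sideLength ρ N),
        periodicEnergy v Ψ ≤ periodicGroundStateEnergy v N (sideLength ρ N) + δ →
        (∀ X, Ψ.ψ X = ((‖Ψ.ψ X‖ : ℝ) : ℂ)) →
        ENNReal.ofReal (c * N) ≤ condensateOccupation N (sideLength ρ N) Ψ.ψ) :
    ∃ ρ' : ℝ, 0 < ρ' ∧ ∀ ρ : ℝ, 0 < ρ → ρ < ρ' → ∃ c : ℝ, 0 < c ∧ ∀ᶠ N : ℕ in Filter.atTop,
      ∃ δ : ℝ≥0∞, 0 < δ ∧ ∀ Ψ : PeriodicTrialState N (sideLength ρ N),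
        periodicEnergy v Ψ ≤ periodicGroundStateEnergy v N (sideLength ρ N) + δ →
        ENNReal.ofReal (c * N) ≤ condensateOccupation N (sideLength ρ N) Ψ.ψ := by
  obtain ⟨ρ₂, hρ₂, hfin⟩ := exists_eventually_periodicGroundStateEnergy_lt_top hv
  refine ⟨min ρ₀ (min ρ₁ ρ₂), lt_min hρ₀ (lt_min hρ₁ hρ₂), fun ρ hρ hρlt => ?_⟩
  have hρlt₀ : ρ < ρ₀ := hρlt.trans_le (min_le_left _ _)
  have hρlt₁ : ρ < ρ₁ := hρlt.trans_le ((min_le_right _ _).trans (min_le_left _ _))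
  have hρlt₂ : ρ < ρ₂ := hρlt.trans_le ((min_le_right _ _).trans (min_le_right _ _))
  obtain ⟨c, hc, hev⟩ := hnn ρ hρ hρlt₀
  refine ⟨c / 2, half_pos hc, ?_⟩
  filter_upwards [hev, hgap ρ hρ hρlt₁, hfin ρ hρ hρlt₂, eventually_gt_atTop 0] with N hN hG hF hN0
  obtain ⟨δ₁, hδ₁, hnonneg⟩ := hN
  -- the side of the torus
  have hL : 0 < sideLength ρ N :=
    Real.rpow_pos_of_pos (div_pos (Nat.cast_pos.2 hN0) hρ) _
  -- stability with `ε = c/2`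
  obtain ⟨δ₂, hδ₂, hstab⟩ :=
    condensateOccupation_le_of_nearMinimisers_of_kyFanGap hv.1 N hL hF.ne hG (half_pos hc)
  refine ⟨min δ₁ δ₂, lt_min hδ₁ hδ₂, fun Ψ hΨ => ?_⟩
  -- a nonnegative `δ`-near-minimiser, on which the hypothesis fires
  obtain ⟨Φ, hΦnn, hΦE⟩ := exists_nonneg_nearMinimiser_of_ne_top v hL hF.ne (lt_min hδ₁ hδ₂)
  have h1 : ENNReal.ofReal (c * N) ≤ condensateOccupation N (sideLength ρ N) Φ.ψ :=
    hnonneg Φ (hΦE.trans (add_le_add le_rfl (min_le_left _ _))) hΦnn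
  -- transfer to `Ψ`
  have h2 : condensateOccupation N (sideLength ρ N) Φ.ψ ≤
      condensateOccupation N (sideLength ρ N) Ψ.ψ + ENNReal.ofReal (c / 2 * N) :=
    hstab Φ Ψ (hΦE.trans (add_le_add le_rfl (min_le_right _ _)))
      (hΨ.trans (add_le_add le_rfl (min_le_right _ _)))
  have hsplit : ENNReal.ofReal (c * N) = ENNReal.ofReal (c / 2 * N) + ENNReal.ofReal (c / 2 * N) := by
    rw [← ENNReal.ofReal_add (by positivity) (by positivity)]
    congr 1
    ring
  rw [hsplit] at h1
  exact ENNReal.le_of_add_le_add_right ENNReal.ofReal_ne_top (h1.trans h2)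

/-! ### The route decl, conditionally on the dilute periodic Ky Fan gap -/

/-- **`PositivityReduction` from the dilute periodic Ky Fan gap** (item stmt-AtomisticToContinuum-11998
of route `BECHusimiAmplitudeGas`, conditional form, the conclusion being the route decl by name).
Hypothesis: for every repulsive finite-range `v` there is `ρ₁ > 0` such that for `0 < ρ < ρ₁` and all
large `N`, `2 · periodicGroundStateEnergy v N L_N < kyFanTwo v N L_N` (`L_N = (N/ρ)^{1/3}`): the
bosonic periodic ground state is simple. Then `PeriodicBECNonneg` implies, for every admissible `v`,
constant-mode BEC for all periodic near-minimisers (the antecedent of `BoundaryTransferWeak`):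
`periodicBEC_of_periodicBECNonneg_of_kyFanGap`. The hypothesis holds for bounded `v`
(`kyFanGap_eventually_of_bounded`); for hard cores it is open (connectedness of the dilute hard-sphere
configuration space of the torus). [folklore] -/
theorem positivityReduction_of_kyFanGap
    (hgap : ∀ v : ℝ → ℝ≥0∞, IsRepulsiveFiniteRange v → ∃ ρ₁ : ℝ, 0 < ρ₁ ∧ ∀ ρ : ℝ, 0 < ρ → ρ < ρ₁ →
      ∀ᶠ N : ℕ in Filter.atTop,
        2 * periodicGroundStateEnergy v N (sideLength ρ N) < kyFanTwo v N (sideLength ρ N)) :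
    Summit.AtomisticToContinuum.BoseEinsteinCondensation.Theses.BECHusimiAmplitudeGas.PositivityReduction := by
  intro hBEC v hv
  obtain ⟨ρ₀, hρ₀, H⟩ := hBEC v hv
  obtain ⟨ρ₁, hρ₁, G⟩ := hgap v hv
  exact periodicBEC_of_periodicBECNonneg_of_kyFanGap hv hρ₀ hρ₁ G H

/-! ### The hypothesis holds for bounded potentials -/

/-- **The Ky Fan gap for bounded potentials** (tree): for measurable, bounded, finite-range `v`,
`N ≥ 1` and `L > 0`, `2 · periodicGroundStateEnergy v N L < kyFanTwo v N L`
(`PeriodicGroundStateNondegenerate_holds` on the bounded periodisation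
`exists_bound_periodizedPotential`). [cite: ReedSimonIV1978, §XIII.12 Thms XIII.43–XIII.46] -/
theorem two_mul_periodicGroundStateEnergy_lt_kyFanTwo_of_bounded {v : ℝ → ℝ≥0∞} (hmeas : Measurable v)
    {R₀ : ℝ} (hR₀ : ∀ r, R₀ < r → v r = 0) {M : ℝ≥0} (hM : ∀ r, v r ≤ M) (hN : 1 ≤ N) (hL : 0 < L) :
    2 * periodicGroundStateEnergy v N L < kyFanTwo v N L := by
  obtain ⟨C, hC⟩ := exists_bound_periodizedPotential hL hM hR₀
  exact PeriodicGroundStateNondegenerate_holds N L v hN hL hmeas ⟨C, hC⟩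

/-- **The dilute periodic Ky Fan gap holds for bounded potentials** (at every density, all `N ≥ 1`):
the hypothesis of `positivityReduction_of_kyFanGap` restricted to bounded `v`, with `ρ₁ = 1`.
[cite: ReedSimonIV1978, §XIII.12 Thms XIII.43–XIII.46] -/
theorem kyFanGap_eventually_of_bounded {v : ℝ → ℝ≥0∞} (hv : IsRepulsiveFiniteRange v)
    (hbdd : ∃ M : ℝ≥0, ∀ r, v r ≤ M) :
    ∃ ρ₁ : ℝ, 0 < ρ₁ ∧ ∀ ρ : ℝ, 0 < ρ → ρ < ρ₁ → ∀ᶠ N : ℕ in Filter.atTop,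
      2 * periodicGroundStateEnergy v N (sideLength ρ N) < kyFanTwo v N (sideLength ρ N) := by
  obtain ⟨hmeas, R₀, hR₀⟩ := hv
  obtain ⟨M, hM⟩ := hbdd
  refine ⟨1, one_pos, fun ρ hρ _ => ?_⟩
  filter_upwards [eventually_ge_atTop 1] with N hN
  have hL : 0 < sideLength ρ N :=
    Real.rpow_pos_of_pos (div_pos (Nat.cast_pos.2 hN) hρ) _
  exact two_mul_periodicGroundStateEnergy_lt_kyFanTwo_of_bounded hmeas hR₀ hM hN hL

end Summit.AtomisticToContinuum.BoseEinsteinCondensation.Theorems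

end
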